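import Mathlib
import Summits.Ventures.HodgeRepro.Tier4.Line1.RTFSetting

/-!
# Tier4/Line1/KernelSupportFinite — LINE L1, lemmas L1.0 `kernel_support_finite`, L1.0′ `geoSupport_finite`, the
shared uniform version `kernel_support_finite_uniform`, and the continuity of the kernel `kernel_continuous`

Blind re-derivation cell `pub-hodge-repro`, Tier 4 «prove the step» (README §9–§10), seat t4-L1-p1 (prover, gen 0),
assignment lead S12132 / S12152 on LINE L1 (t4-plan-1, «LINE L1 FILED 12c8528bc811170c… 949», v0.8); the uniform
version was asked by t4-plan-1 (S12174 (3)) for the consumers L1.1 (t4-L1-p2) and L1.2b (t4-L1-p4).  The two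
skeleton statements are restated BYTE-IDENTICALLY from `proofs/t4-plan-1/Tier4/Line1/Skeleton.lean` (L380–L382, L386)
inside `namespace Summit.Ventures.HodgeRepro.Tier4.Line1.RTF.Setting` with `variable (S : Setting G)`, over the
generic relative-trace-formula layer `Tier4/Line1/RTFSetting.lean` (p661834, imported by name).  No `sorry`;
axioms = the trio.

THE MATHEMATICS (one sentence each).  A closed discrete subgroup `G(k) ⊆ G` meets every compact subset of `G` in
finitely many points: `Subtype.val : G(k) → G` is a closed embedding (`S.closed`), so the preimage of a compact set is
compact in `G(k)`, hence finite because `G(k)` is discrete (`S.discrete`) — `finite_of_subset_compact`.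
* `kernel_support_finite_uniform`: for compact `C₁, C₂ ⊆ G`, the rational `γ` with `f (x⁻¹ γ y) ≠ 0` for some
  `x ∈ C₁`, `y ∈ C₂` satisfy `γ = x · (x⁻¹ γ y) · y⁻¹ ∈ C₁ · tsupport f · C₂⁻¹`, the continuous image of the compact
  `C₁ ×ˢ tsupport f ×ˢ C₂` (`hf.compact`).
* L1.0 `kernel_support_finite` is the case `C₁ = {x}`, `C₂ = {y}`.
* L1.0′ `geoSupport_finite`: a rational double coset in `geoSupport f` is `orbitOf γ` for some `γ` with
  `f (t⁻¹ γ t') ≠ 0`, `t ∈ DT`, `t' ∈ DT'`; with `C₁ = closure DT`, `C₂ = closure DT'` (compact in `T`, `T'` by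
  `S.compT`, `S.compT'`, hence their images in `G`) these `γ` are finitely many and `geoSupport f` is contained in
  the image of that finite set under `orbitOf`.
* `kernel_continuous` (J1 rung (0′), t4-plan-1 S12221 (3)): `K_f` is jointly continuous on `G × G` — near `(x₀, y₀)`
  only the finitely many rational `γ` with `x₀⁻¹ γ y₀ ∈ tsupport f` contribute (the tube lemma on the compact
  `tsupport f`: a rational value `x₀ s y₀⁻¹` is isolated by discreteness, a non-rational one is kept away from `G(k)` by
  closedness), so `K_f` is locally a finite sum of continuous functions; no local compactness of `G` is used.

Nothing here says anything about the status of the Hodge conjecture for CM abelian varieties, which is NOT proved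
(HC_CM is NOT proved by anyone in this repository).
-/

set_option autoImplicit false

noncomputable section

namespace Summit.Ventures.HodgeRepro.Tier4.Line1

open MeasureTheory Topology

namespace RTF

variable {G : Type} [Group G] [TopologicalSpace G] [IsTopologicalGroup G] [MeasurableSpace G]
  [BorelSpace G]

namespace Setting

variable (S : Setting G)

omit [IsTopologicalGroup G] [BorelSpace G] in
/-- helper (proved): a set of rational points whose image in `G` lies in a compact set is finite — `G(k)` is closed
(`S.closed`, so `Subtype.val` is a closed embedding and the preimage of a compact set is compact) and discrete
(`S.discrete`, so compact sets of `G(k)` are finite). -/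
theorem finite_of_subset_compact {A : Set S.Gk} {K : Set G} (hK : IsCompact K)
    (hAK : ∀ γ ∈ A, (γ : G) ∈ K) : A.Finite := by
  haveI : DiscreteTopology S.Gk := S.discrete
  have hemb : Topology.IsClosedEmbedding ((↑) : S.Gk → G) :=
    S.closed.isClosedEmbedding_subtypeVal
  have hc : IsCompact (((↑) : S.Gk → G) ⁻¹' K) := hemb.isCompact_preimage hK
  exact hc.finite_of_discrete.subset fun γ hγ => hAK γ hγ

omit [BorelSpace G] in
/-- the UNIFORM version of L1.0 (t4-plan-1 S12174 (3), shared with L1.1 and L1.2b): for compact `C₁ C₂ ⊆ G` and a test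
function `f`, finitely many rational `γ` have `f (x⁻¹ γ y) ≠ 0` for some `x ∈ C₁`, `y ∈ C₂` — such a `γ` lies in the
compact `C₁ · tsupport f · C₂⁻¹`. -/
theorem kernel_support_finite_uniform {f : G → ℂ} (hf : IsTest f) {C₁ C₂ : Set G} (h₁ : IsCompact C₁)
    (h₂ : IsCompact C₂) : {γ : S.Gk | ∃ x ∈ C₁, ∃ y ∈ C₂, f (x⁻¹ * γ * y) ≠ 0}.Finite := by
  have hC : IsCompact ((fun p : G × G × G => p.1 * p.2.1 * p.2.2⁻¹) ''
      (C₁ ×ˢ tsupport f ×ˢ C₂)) := by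
    refine (h₁.prod (hf.compact.isCompact.prod h₂)).image ?_
    exact (continuous_fst.mul (continuous_fst.comp continuous_snd)).mul
      (continuous_snd.comp continuous_snd).inv
  refine S.finite_of_subset_compact hC ?_
  rintro γ ⟨x, hx, y, hy, hne⟩
  refine ⟨(x, x⁻¹ * γ * y, y), ⟨hx, subset_tsupport f hne, hy⟩, ?_⟩
  show x * (x⁻¹ * γ * y) * y⁻¹ = γ
  group

omit [BorelSpace G] in
/-- L1.0 (M): `G(k)` is discrete and closed and `f` has compact support, so finitely many rational `γ`
contribute to the kernel at `(x, y)`. -/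
theorem kernel_support_finite {f : G → ℂ} (hf : IsTest f) (x y : G) :
    {γ : S.Gk | f (x⁻¹ * γ * y) ≠ 0}.Finite := by
  refine (S.kernel_support_finite_uniform hf (C₁ := {x}) (C₂ := {y}) isCompact_singleton
    isCompact_singleton).subset ?_
  intro γ hγ
  exact ⟨x, Set.mem_singleton x, y, Set.mem_singleton y, hγ⟩

omit [BorelSpace G] in
/-- L1.0′ (M): the rational double cosets meeting the support of `f` on the relatively compact
`DT × DT'` are finitely many. -/
theorem geoSupport_finite {f : G → ℂ} (hf : IsTest f) : (S.geoSupport f).Finite := by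
  have h₁ : IsCompact (((↑) : S.T → G) '' closure S.DT) := S.compT.image continuous_subtype_val
  have h₂ : IsCompact (((↑) : S.T' → G) '' closure S.DT') := S.compT'.image continuous_subtype_val
  refine ((S.kernel_support_finite_uniform hf h₁ h₂).image S.orbitOf).subset ?_
  rintro o ⟨t, ht, t', ht', γ, rfl, hne⟩
  exact ⟨γ, ⟨t, ⟨t, subset_closure ht, rfl⟩, t', ⟨t', subset_closure ht', rfl⟩, hne⟩, rfl⟩

omit [BorelSpace G] in
/-- J1 rung (0′) (M): the kernel of a test function is jointly continuous on `G × G` — near every `(x₀, y₀)` only the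
finitely many rational `γ` with `x₀⁻¹ γ y₀ ∈ tsupport f` contribute (`Gk` closed and discrete, `tsupport f` compact:
the tube lemma `IsCompact.eventually_forall_of_forall_eventually`), so `K_f` is locally a finite sum of continuous
functions.  No local compactness of `G` is needed. -/
theorem kernel_continuous {f : G → ℂ} (hf : IsTest f) : Continuous fun p : G × G => S.kernel f p.1 p.2 := by
  haveI : DiscreteTopology S.Gk := S.discrete
  rw [continuous_iff_continuousAt]
  rintro ⟨x₀, y₀⟩
  -- the finitely many rational points contributing at `(x₀, y₀)`
  have hK : IsCompact ((fun g : G => x₀ * g * y₀⁻¹) '' tsupport f) :=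
    hf.compact.isCompact.image ((continuous_const.mul continuous_id).mul continuous_const)
  have hFfin : {γ : S.Gk | x₀⁻¹ * γ * y₀ ∈ tsupport f}.Finite := by
    refine S.finite_of_subset_compact hK ?_
    intro γ hγ
    exact ⟨x₀⁻¹ * γ * y₀, hγ, by group⟩
  -- the continuous map `((x, y), s) ↦ x s y⁻¹`
  have hm : Continuous fun z : (G × G) × G => z.1.1 * z.2 * z.1.2⁻¹ :=
    ((continuous_fst.comp continuous_fst).mul continuous_snd).mul
      (continuous_snd.comp continuous_fst).inv
  -- the tube lemma: near `(x₀, y₀)`, every rational point meeting the support is one of the finitely many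
  have hev : ∀ᶠ p : G × G in 𝓝 (x₀, y₀), ∀ s ∈ tsupport f, ∀ γ : S.Gk,
      (γ : G) = p.1 * s * p.2⁻¹ → γ ∈ {γ : S.Gk | x₀⁻¹ * γ * y₀ ∈ tsupport f} := by
    refine hf.compact.isCompact.eventually_forall_of_forall_eventually ?_
    intro s hs
    by_cases hγ₁ : x₀ * s * y₀⁻¹ ∈ S.Gk
    · -- a rational point: discreteness isolates it
      obtain ⟨V, hVo, hV⟩ :=
        isOpen_induced_iff.mp (isOpen_discrete ({(⟨_, hγ₁⟩ : S.Gk)} : Set S.Gk))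
      have hmem : x₀ * s * y₀⁻¹ ∈ V := by
        have : (⟨_, hγ₁⟩ : S.Gk) ∈ Subtype.val ⁻¹' V := by
          rw [hV]
          exact Set.mem_singleton _
        exact this
      filter_upwards [hm.continuousAt.preimage_mem_nhds (hVo.mem_nhds hmem)] with z hz γ hγz
      have hγV : γ ∈ (Subtype.val ⁻¹' V : Set S.Gk) := by
        show (γ : G) ∈ V
        rw [hγz]
        exact hz
      rw [hV, Set.mem_singleton_iff] at hγV
      rw [hγV]
      show x₀⁻¹ * (x₀ * s * y₀⁻¹) * y₀ ∈ tsupport f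
      have hs' : x₀⁻¹ * (x₀ * s * y₀⁻¹) * y₀ = s := by group
      rw [hs']
      exact hs
    · -- not a rational point: closedness keeps a neighbourhood away from `Gk`
      have hopen : IsOpen ((S.Gk : Set G)ᶜ) := S.closed.isOpen_compl
      have hmem : x₀ * s * y₀⁻¹ ∈ (S.Gk : Set G)ᶜ := hγ₁
      filter_upwards [hm.continuousAt.preimage_mem_nhds (hopen.mem_nhds hmem)] with z hz γ hγz
      have h2 : (γ : G) ∈ S.Gk := γ.2
      rw [hγz] at h2
      exact absurd h2 hz
  -- on that neighbourhood the kernel is the finite sum over the contributing rational points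
  have hloc : (fun p : G × G => S.kernel f p.1 p.2) =ᶠ[𝓝 (x₀, y₀)]
      fun p : G × G => ∑ γ ∈ hFfin.toFinset, f (p.1⁻¹ * γ * p.2) := by
    filter_upwards [hev] with p hp
    unfold kernel
    apply tsum_eq_sum
    intro γ hγ
    by_contra hne
    apply hγ
    rw [hFfin.mem_toFinset]
    exact hp _ (subset_tsupport f hne) γ (by group)
  refine ContinuousAt.congr ?_ hloc.symm
  exact (continuous_finsetSum _ fun γ _ =>
    hf.cont.comp ((continuous_fst.inv.mul continuous_const).mul continuous_snd)).continuousAt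

end Setting

end RTF

end Summit.Ventures.HodgeRepro.Tier4.Line1
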